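import Literature.Algebra.Homology.CrossedHomCoboundaryCriteria
import Mathlib.GroupTheory.Sylow
import Mathlib.Data.Nat.Factorization.Basic
import HarnessLib

/-!
# Crossed homomorphisms: the transfer identity `cor ∘ res = [Γ : H]` in element form and the Sylow
# criterion `(∀ p, H¹(Γ_p, G) ∋ res f = 0) ⟹ f = 0 in H¹(Γ, G)` (Serre, *Local Fields* VII §7 Prop. 6,
# IX §2 Thm. 4 Cor.; Cassels–Fröhlich IV §6 Prop. 8 Cor. 3)

Topic `Algebra/Homology`; namespace `Literature.Algebra.Homology.CrossedHomElem`.  Proof file: theorems only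
(no definition, no named fact, no instance).  Sequel to `CrossedHomCoboundaryCriteria` (same setting: a group
`Γ` acting on a commutative group `G` through `act : Γ → (G →* G)`, `act (g h) = act g ∘ act h`, `act 1 = id`;
crossed homomorphisms `f (g h) = act g (f h) · f g`, coboundaries `g ↦ act g c / c`).

* §1 **`exists_coboundary_pow_index_of_restrict`** — if the restriction of a crossed homomorphism `f` to a
  subgroup `H` of finite index `m` is a coboundary, then `f^m` is a coboundary.  This is `cor ∘ res = m` on
  `H¹` (Serre VII §7 Prop. 6) made explicit on cocycles: with left coset representatives `s`,
  `g s(q) = s(g q) h_q`, one has `∏_q s(gq) • f(h_q) = g • c · f(g)^m / c` (`c = ∏_q f(s q)`) by the cocycle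
  rule, and `= g • d' / d'` (`d' = ∏_q s(q) • d`) when `f|_H = ∂d`.
* §2 **`exists_coboundary_of_sylow`** — for `Γ` finite: if `res_P f` is a coboundary for one Sylow
  `p`-subgroup `P` for every prime `p`, then `f` is a coboundary (Serre IX §2 Thm. 4 and VII §7: `H¹(Γ, G)`
  embeds in `⊕_p H¹(Γ_p, G)` on `p`-primary parts; here: the set of `k > 0` with `f^k` a coboundary contains
  every index `[Γ : Γ_p]`, whose gcd is `1`).

## References

* J.-P. Serre, *Local Fields*, GTM 67 (1979), Ch. VII §7 Prop. 6 (`Cor ∘ Res = n`), Ch. IX §2 Thm. 4 and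
  its Corollary (restriction to Sylow subgroups is injective on `p`-components). [SerreLocalFields1979]
* J. W. S. Cassels, A. Fröhlich (eds.), *Algebraic Number Theory* (1967), Ch. IV (Atiyah–Wall) §6 Prop. 8
  and Cor. 3. [CasselsFrohlichANT1967]
-/

namespace Literature.Algebra.Homology.CrossedHomElem

open Finset

/-! ## §1. `res_H f` a coboundary ⟹ `f ^ [Γ : H]` a coboundary -/

section Transfer

variable {Γ G : Type*} [Group Γ] [CommGroup G] (act : Γ → G →* G)

/-- **`cor ∘ res = [Γ : H]` on `H¹`, element form** (Serre VII §7 Prop. 6): if the restriction to a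
subgroup `H` of finite index of a crossed homomorphism `f : Γ → G` is a coboundary (`f h = h • d / d` for
`h ∈ H`), then `g ↦ f(g) ^ [Γ : H]` is a coboundary.  With left coset representatives `s : Γ/H → Γ` and
`g · s(q) = s(g q) · h_q`, `h_q ∈ H`: the cocycle rule gives `s(gq) • f(h_q) = g • f(s q) · f g / f(s(gq))`, whose
product over `q` is `g • c · f(g)^m / c`, `c = ∏_q f(s q)`; and `f(h_q) = h_q • d / d` gives
`s(gq) • f(h_q) = (g s(q)) • d / s(gq) • d`, whose product is `g • d' / d'`, `d' = ∏_q s(q) • d`.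
[cite: SerreLocalFields1979, Ch. VII §7 Prop. 6] -/
theorem exists_coboundary_pow_index_of_restrict (hmul : ∀ g h x, act (g * h) x = act g (act h x))
    (H : Subgroup Γ) [H.FiniteIndex] {f : Γ → G} (hf : ∀ g h, f (g * h) = act g (f h) * f g)
    (hres : ∃ d : G, ∀ h ∈ H, act h d / d = f h) :
    ∃ e : G, ∀ g, act g e / e = f g ^ H.index := by
  classical
  haveI : Fintype (Γ ⧸ H) := Fintype.ofFinite _
  obtain ⟨d, hd⟩ := hres
  -- left coset representatives
  set s : Γ ⧸ H → Γ := fun q => Quotient.out q with hs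
  have hsq : ∀ q : Γ ⧸ H, ((s q : Γ) : Γ ⧸ H) = q := fun q => QuotientGroup.out_eq' q
  -- `h_q := s(gq)⁻¹ (g s(q)) ∈ H`
  have hmem : ∀ (g : Γ) (q : Γ ⧸ H), (s (g • q))⁻¹ * (g * s q) ∈ H := fun g q => by
    rw [← QuotientGroup.eq, hsq, ← smul_eq_mul g (s q), ← MulAction.Quotient.smul_coe, hsq]
  set c : G := ∏ q : Γ ⧸ H, f (s q) with hc
  set d' : G := ∏ q : Γ ⧸ H, act (s q) d with hd'
  refine ⟨d' / c, fun g => ?_⟩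
  -- the two evaluations of `∏_q s(gq) • f(h_q)`
  have h1 : ∀ q : Γ ⧸ H, act (s (g • q)) (f ((s (g • q))⁻¹ * (g * s q))) =
      act g (f (s q)) * f g / f (s (g • q)) := fun q => by
    rw [eq_div_iff_mul_eq', ← hf, mul_inv_cancel_left, hf]
  have h2 : ∀ q : Γ ⧸ H, act (s (g • q)) (f ((s (g • q))⁻¹ * (g * s q))) =
      act g (act (s q) d) / act (s (g • q)) d := fun q => by
    rw [← hd _ (hmem g q), map_div, ← hmul, mul_inv_cancel_left, hmul]
  have hreindex : ∀ F : Γ ⧸ H → G, ∏ q : Γ ⧸ H, F (g • q) = ∏ q : Γ ⧸ H, F q := fun F =>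
    Fintype.prod_bijective (g • ·) (MulAction.bijective g) (fun q => F (g • q)) F fun _ => rfl
  have hP1 : ∏ q : Γ ⧸ H, act (s (g • q)) (f ((s (g • q))⁻¹ * (g * s q))) =
      act g c * f g ^ H.index / c := by
    simp_rw [h1]
    rw [prod_div_distrib, prod_mul_distrib, prod_const, card_univ, map_prod,
      hreindex (fun q => f (s q)), Subgroup.index_eq_card, Nat.card_eq_fintype_card]
  have hP2 : ∏ q : Γ ⧸ H, act (s (g • q)) (f ((s (g • q))⁻¹ * (g * s q))) = act g d' / d' := by
    simp_rw [h2]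
    rw [prod_div_distrib, map_prod, hreindex (fun q => act (s q) d)]
  -- conclude
  rw [map_div, div_div_div_comm, ← hP2, hP1, mul_comm (act g c), mul_div_assoc, mul_div_cancel_right]

/-- The case `H = ⊥` of `exists_coboundary_pow_index_of_restrict` for `Γ` finite: `f ^ #Γ` is a coboundary
(`H¹(Γ, G)` is killed by `#Γ`). [cite: SerreLocalFields1979, Ch. VIII §2 Cor. 1 (to Prop. 4)] -/
theorem exists_coboundary_pow_card [Finite Γ] (hmul : ∀ g h x, act (g * h) x = act g (act h x))
    (hone : ∀ x, act 1 x = x) {f : Γ → G} (hf : ∀ g h, f (g * h) = act g (f h) * f g) :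
    ∃ e : G, ∀ g, act g e / e = f g ^ Nat.card Γ := by
  obtain ⟨e, he⟩ := exists_coboundary_pow_index_of_restrict act hmul ⊥ hf
    ⟨1, fun h hh => by rw [Subgroup.mem_bot.mp hh, hone, div_one, map_one_of_crossed act hone hf]⟩
  exact ⟨e, fun g => by rw [he, Subgroup.index_bot]⟩

end Transfer

/-! ## §2. The Sylow criterion -/

section Sylow

variable {Γ G : Type*} [Group Γ] [CommGroup G] (act : Γ → G →* G)

omit [Group Γ] in
/-- If `f^k` and `f^l` are coboundaries then so is `f^(l mod k)` (the exponents `k` with `f^k` a coboundary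
are the non-negative part of a subgroup of `ℤ`). [folklore] -/
private theorem coboundary_pow_mod {f : Γ → G} {k l : ℕ}
    (hk : ∃ e : G, ∀ g, act g e / e = f g ^ k) (hl : ∃ e : G, ∀ g, act g e / e = f g ^ l) :
    ∃ e : G, ∀ g, act g e / e = f g ^ (l % k) := by
  obtain ⟨e₁, he₁⟩ := hk
  obtain ⟨e₂, he₂⟩ := hl
  refine ⟨e₂ / e₁ ^ (l / k), fun g => ?_⟩
  have hsplit : f g ^ l = f g ^ (l % k) * (f g ^ k) ^ (l / k) := by
    rw [← pow_mul, ← pow_add, Nat.mod_add_div l k]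
  rw [map_div, map_pow, div_div_div_comm, he₂, ← div_pow, he₁, hsplit, mul_div_cancel_right]

/-- **The Sylow criterion for `H¹`, element form** (Serre IX §2 Thm. 4 with VII §7 Prop. 6: the
restriction `H¹(Γ, G) → ⊕_p H¹(Γ_p, G)` is injective): for a finite group `Γ`, a crossed homomorphism
`f : Γ → G` whose restriction to a Sylow `p`-subgroup is a coboundary for every prime `p` is a coboundary.
Proof: the exponents `k > 0` with `f^k` a coboundary are closed under remainders (`coboundary_pow_mod`) and
contain `#Γ` and every index `[Γ : Γ_p]` (`exists_coboundary_pow_index_of_restrict`); the least one divides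
each `[Γ : Γ_p]`, which is prime to `p` (`Sylow.not_dvd_index`), hence it is `1`.
[cite: SerreLocalFields1979, Ch. IX §2 Thm. 4 (Cor.)] -/
theorem exists_coboundary_of_sylow [Finite Γ] (hmul : ∀ g h x, act (g * h) x = act g (act h x))
    (hone : ∀ x, act 1 x = x) {f : Γ → G} (hf : ∀ g h, f (g * h) = act g (f h) * f g)
    (hSyl : ∀ (p : ℕ) [Fact p.Prime] (P : Sylow p Γ),
      ∃ d : G, ∀ h ∈ (P : Subgroup Γ), act h d / d = f h) :
    ∃ c : G, ∀ g, act g c / c = f g := by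
  classical
  have hex : ∃ k : ℕ, 0 < k ∧ ∃ e : G, ∀ g, act g e / e = f g ^ k :=
    ⟨Nat.card Γ, Nat.card_pos, exists_coboundary_pow_card act hmul hone hf⟩
  obtain ⟨hk₀pos, hk₀⟩ := Nat.find_spec hex
  -- minimality: the least exponent divides every exponent
  have hdvd : ∀ k, (∃ e : G, ∀ g, act g e / e = f g ^ k) → Nat.find hex ∣ k := fun k hk => by
    by_contra hnd
    have hpos : 0 < k % Nat.find hex := Nat.pos_of_ne_zero fun h => hnd (Nat.dvd_of_mod_eq_zero h)
    exact Nat.find_min hex (Nat.mod_lt k hk₀pos) ⟨hpos, coboundary_pow_mod act hk₀ hk⟩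
  -- no prime divides it: it divides the index of a Sylow `p`-subgroup
  have hone' : Nat.find hex = 1 := by
    refine Nat.eq_one_iff_not_exists_prime_dvd.mpr fun p hp hpd => ?_
    haveI : Fact p.Prime := ⟨hp⟩
    obtain ⟨P⟩ := (Sylow.nonempty : Nonempty (Sylow p Γ))
    have hidx : Nat.find hex ∣ (P : Subgroup Γ).index :=
      hdvd _ (exists_coboundary_pow_index_of_restrict act hmul (P : Subgroup Γ) hf (hSyl p P))
    exact P.not_dvd_index (hpd.trans hidx)
  obtain ⟨e, he⟩ := hk₀
  exact ⟨e, fun g => by rw [he, hone', pow_one]⟩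

end Sylow

end Literature.Algebra.Homology.CrossedHomElem
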